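import Summits.SmoothPoincare4.SmoothPoincare4.Theses.SymplecticOrigami
import Literature.Topology.FourManifolds.Morse
import Summits.SmoothPoincare4.SmoothPoincare4.Theorems.SymplecticOrigamiOrigamiRungStubBallFunctionCalculus

/-!
# Stub `stub_ballFunction` of line `pair-rigidity-endgame`, part 2: charts

* `exists_slice_box` — around a point of a smoothly embedded hypersurface `f : S → X`
  (`X` modelled on `ℝⁿ⁺¹`): a chart `φ` of the maximal atlas and a splitting `T : ℝⁿ⁺¹ ≃L ℝⁿ × ℝ`
  such that, inside a small box, `range f` is exactly the slice `{last coordinate = 0}`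
  (Mathlib's immersion normal form `Manifold.IsImmersionAt` plus the topological-embedding half
  of `IsSmoothEmbedding`).

For a map `F : M → V` from an `m`-manifold (model `𝓡 m`) to a real inner product space, smooth on
an open set `A`, and the *ball function* `f = -(√(1 + ‖F‖²))⁻¹` on `A`:

* `chart_facts` — `F` read in the extended chart at `y ∈ A` is smooth on an open neighbourhood of
  the chart point, and `mfderiv F y` is its derivative there;
* `apply_eq_zero_of_mfderiv_eq_zero` — where `dF` is onto, a critical point of `f` is a zero of
  `F`;
* `mfderiv_eq_zero_and_posDef_mhessian` — at a zero of `F` where `dF` is injective, `f` is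
  critical with positive-definite Hessian (`Literature.Topology.FourManifolds.mhessian`);
  `stub_ballFunction_posDefHessian` is its universe-monomorphic export (the registered sub-goal);
* `mfderiv_comp_ne_zero` — post-composing a real function with non-zero derivative keeps a
  point non-critical.

All folklore; the model-space derivatives are in part 1
(`SymplecticOrigamiOrigamiRungStubBallFunctionCalculus.lean`).
-/

noncomputable section

-- the prescribed namespace `Summit.<P>.<Sub>.…` duplicates `SmoothPoincare4` (P = Sub)
set_option linter.dupNamespace false

open scoped Manifold ContDiff Topology ContinuousMap RealInnerProductSpace
open Set TopologicalSpace
open Literature.Topology.FourManifolds (singularHomologyZ sphereInversion IsTwistedSphere)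
open Literature.Geometry.Kaehler (MForm IsSmoothForm IsClosedForm)

namespace Summit.SmoothPoincare4.SmoothPoincare4.Theorems.OrigamiRung.PairRigidityEndgame

/-! ### A slice box around a point of an embedded hypersurface -/

section SliceBox

variable {n : ℕ} {S : Type*} [TopologicalSpace S] [ChartedSpace (EuclideanSpace ℝ (Fin n)) S]
  {X : Type*} [TopologicalSpace X] [ChartedSpace (EuclideanSpace ℝ (Fin (n + 1))) X] {f : S → X}

/-- **Slice box.** Let `f : S → X` be a smooth embedding of an `n`-manifold into an
`(n+1)`-manifold and `z₀ ∈ S`. There are a chart `φ` of the maximal `C^∞` atlas of `X` at `f z₀`,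
a splitting `T : ℝⁿ⁺¹ ≃L ℝⁿ × ℝ` with `T (φ (f z₀))` on the slice `{s = 0}`, and a radius `r > 0`
such that the ball of radius `r` around `T (φ (f z₀))` lies in `T (φ.target)` and, for `x` in the
box `{x ∈ φ.source | T (φ x) ∈ ball}`, `x ∈ range f ↔ (T (φ x)).2 = 0`. (The charts are Mathlib's
immersion data at `z₀`, in which `f` reads `u ↦ (u, 0)`; the radius is small enough that, `f`
being a topological embedding, no other sheet of `range f` enters the box.)
[cite: LeeSmoothManifolds2013, Thm. 5.8 and Prop. 5.2] -/
theorem exists_slice_box (hf : Manifold.IsSmoothEmbedding (𝓡 n) (𝓡 (n + 1)) ∞ f) (z₀ : S) :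
    ∃ (φ : OpenPartialHomeomorph X (EuclideanSpace ℝ (Fin (n + 1))))
      (T : (EuclideanSpace ℝ (Fin (n + 1))) ≃L[ℝ] (EuclideanSpace ℝ (Fin n)) × ℝ) (r : ℝ),
      0 < r ∧ φ ∈ IsManifold.maximalAtlas (𝓡 (n + 1)) ∞ X ∧ f z₀ ∈ φ.source ∧
      (T (φ (f z₀))).2 = 0 ∧
      (∀ q ∈ Metric.ball (T (φ (f z₀))) r, T.symm q ∈ φ.target) ∧
      ∀ x ∈ φ.source, T (φ x) ∈ Metric.ball (T (φ (f z₀))) r →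
        (x ∈ range f ↔ (T (φ x)).2 = 0) := by
  have hi : Manifold.IsImmersionAt (𝓡 n) (𝓡 (n + 1)) ∞ f z₀ := hf.isImmersion.isImmersionAt z₀
  -- the complement in the immersion data is a line; straighten `ℝⁿ⁺¹ ≃ ℝⁿ × ℝ`
  haveI : FiniteDimensional ℝ hi.complement := by
    haveI : Module.Finite ℝ ((EuclideanSpace ℝ (Fin n)) × hi.complement) :=
      Module.Finite.equiv hi.equiv.toLinearEquiv.symm
    exact Module.Finite.of_injective (LinearMap.inr ℝ (EuclideanSpace ℝ (Fin n)) hi.complement)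
      LinearMap.inr_injective
  have hrank : Module.finrank ℝ hi.complement = Module.finrank ℝ ℝ := by
    have h := hi.equiv.toLinearEquiv.finrank_eq
    rw [Module.finrank_prod, finrank_euclideanSpace_fin, finrank_euclideanSpace_fin] at h
    rw [Module.finrank_self]
    omega
  obtain ⟨T, hT⟩ : ∃ T : (EuclideanSpace ℝ (Fin (n + 1))) ≃L[ℝ] (EuclideanSpace ℝ (Fin n)) × ℝ,
      ∀ a : EuclideanSpace ℝ (Fin n), T (hi.equiv (a, 0)) = (a, 0) := by
    refine ⟨hi.equiv.symm.trans ((ContinuousLinearEquiv.refl ℝ (EuclideanSpace ℝ (Fin n))).prodCongr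
      (ContinuousLinearEquiv.ofFinrankEq hrank)), fun a => ?_⟩
    simp
  -- in the charts `φ = hi.domChart`, `ψ = hi.codChart`, `f` reads `z ↦ T.symm (φ z, 0)`
  have hTf : ∀ z ∈ hi.domChart.source, T (hi.codChart (f z)) = (hi.domChart z, 0) := by
    intro z hz
    have hmem : (hi.domChart.extend (𝓡 n)) z ∈ (hi.domChart.extend (𝓡 n)).target :=
      (hi.domChart.extend (𝓡 n)).map_source
        (by rw [OpenPartialHomeomorph.extend_source]; exact hz)
    have hw := hi.writtenInCharts hmem
    simp only [Function.comp_apply] at hw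
    rw [OpenPartialHomeomorph.extend_left_inv _ hz] at hw
    have h1 : (hi.codChart.extend (𝓡 (n + 1))) (f z) = hi.codChart (f z) := by
      rw [OpenPartialHomeomorph.extend_coe, Function.comp_apply, modelWithCornersSelf_coe, id]
    have h2 : (hi.domChart.extend (𝓡 n)) z = hi.domChart z := by
      rw [OpenPartialHomeomorph.extend_coe, Function.comp_apply, modelWithCornersSelf_coe, id]
    rw [h1, h2] at hw
    rw [hw, hT]
  -- an open set of `X` cutting out the source of the domain chart (`f` is an embedding)
  obtain ⟨Wo, hWo, hWo_pre⟩ := hf.isEmbedding.isInducing.isOpen_iff.mp hi.domChart.open_source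
  have hz₀φ : z₀ ∈ hi.domChart.source := hi.mem_domChart_source
  have hpψ : f z₀ ∈ hi.codChart.source := hi.mem_codChart_source
  -- the admissible region in straightened coordinates, and a ball inside it
  set G : Set ((EuclideanSpace ℝ (Fin n)) × ℝ) :=
    T.symm ⁻¹' (hi.codChart.target ∩ hi.codChart.symm ⁻¹' Wo) ∩ Prod.fst ⁻¹' hi.domChart.target
    with hG
  have hGo : IsOpen G :=
    ((hi.codChart.isOpen_inter_preimage_symm hWo).preimage T.symm.continuous).inter
      (hi.domChart.open_target.preimage continuous_fst)
  have hc : T (hi.codChart (f z₀)) = (hi.domChart z₀, 0) := hTf z₀ hz₀φ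
  have hG₀ : T (hi.codChart (f z₀)) ∈ G := by
    rw [hc]
    refine ⟨?_, hi.domChart.map_source hz₀φ⟩
    show T.symm (hi.domChart z₀, 0) ∈ hi.codChart.target ∩ hi.codChart.symm ⁻¹' Wo
    rw [← hc, ContinuousLinearEquiv.symm_apply_apply]
    refine ⟨hi.codChart.map_source hpψ, ?_⟩
    rw [mem_preimage, hi.codChart.left_inv hpψ, ← mem_preimage, hWo_pre]
    exact hz₀φ
  obtain ⟨r, hr, hball⟩ := Metric.isOpen_iff.mp hGo _ hG₀
  refine ⟨hi.codChart, T, r, hr, hi.codChart_mem_maximalAtlas, hpψ, by rw [hc],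
    fun q hq => (hball hq).1.1, fun x hx hxB => ⟨?_, fun h0 => ?_⟩⟩
  · rintro ⟨z, rfl⟩
    have h1 := (hball hxB).1.2
    simp only [mem_preimage, ContinuousLinearEquiv.symm_apply_apply] at h1
    rw [hi.codChart.left_inv hx] at h1
    have hzφ : z ∈ hi.domChart.source := by rwa [← hWo_pre]
    rw [hTf z hzφ]
  · have ha : (T (hi.codChart x)).1 ∈ hi.domChart.target := (hball hxB).2
    have hzs : hi.domChart.symm (T (hi.codChart x)).1 ∈ hi.domChart.source :=
      hi.domChart.map_target ha
    refine ⟨hi.domChart.symm (T (hi.codChart x)).1, ?_⟩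
    have hfz : f (hi.domChart.symm (T (hi.codChart x)).1) ∈ hi.codChart.source :=
      hi.source_subset_preimage_source hzs
    have hTz :
        T (hi.codChart (f (hi.domChart.symm (T (hi.codChart x)).1))) = T (hi.codChart x) := by
      rw [hTf _ hzs, hi.domChart.right_inv ha]
      exact Prod.ext rfl h0.symm
    exact hi.codChart.injOn hfz hx (T.injective hTz)

end SliceBox

section Chart

variable {m : ℕ} {M : Type*} [TopologicalSpace M] [ChartedSpace (EuclideanSpace ℝ (Fin m)) M]
  {V : Type*} [NormedAddCommGroup V] [InnerProductSpace ℝ V]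

/-- **A vector-valued map read in an extended chart.** If `F : M → V` is smooth on an open set
`A ∋ y`, then in the extended chart `e` at `y` the representative `F ∘ e⁻¹` is smooth on the open
neighbourhood `e.target ∩ e.symm ⁻¹' A` of `e y`, and `mfderiv F y = D(F ∘ e⁻¹)(e y)`. [folklore] -/
theorem chart_facts [IsManifold (𝓡 m) ∞ M] {F : M → V} {A : Set M} (hA : IsOpen A)
    (hF : ContMDiffOn (𝓡 m) 𝓘(ℝ, V) ∞ F A) {y : M} (hy : y ∈ A) :
    IsOpen ((extChartAt (𝓡 m) y).target ∩ (extChartAt (𝓡 m) y).symm ⁻¹' A) ∧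
    extChartAt (𝓡 m) y y ∈ (extChartAt (𝓡 m) y).target ∩ (extChartAt (𝓡 m) y).symm ⁻¹' A ∧
    ContDiffOn ℝ ∞ (F ∘ (extChartAt (𝓡 m) y).symm)
      ((extChartAt (𝓡 m) y).target ∩ (extChartAt (𝓡 m) y).symm ⁻¹' A) ∧
    mfderiv (𝓡 m) 𝓘(ℝ, V) F y =
      fderiv ℝ (F ∘ (extChartAt (𝓡 m) y).symm) (extChartAt (𝓡 m) y y) := by
  refine ⟨(continuousOn_extChartAt_symm y).isOpen_inter_preimage (isOpen_extChartAt_target y) hA,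
    ⟨mem_extChartAt_target y, by rw [mem_preimage, extChartAt_to_inv]; exact hy⟩, ?_, ?_⟩
  · have h := (contMDiffOn_iff.1 hF).2 y (F y)
    simpa only [extChartAt_model_space_eq_id, PartialEquiv.refl_coe, PartialEquiv.refl_source,
      preimage_univ, inter_univ, Function.id_comp] using h
  · have hFd : MDifferentiableAt (𝓡 m) 𝓘(ℝ, V) F y :=
      (hF.contMDiffAt (hA.mem_nhds hy)).mdifferentiableAt (by simp)
    rw [hFd.mfderiv, ModelWithCorners.range_eq_univ, fderivWithin_univ]
    rfl

omit [InnerProductSpace ℝ V] in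
/-- The ball function read in the extended chart at a point of `A` is the ball profile of the
representative of `F`, near the chart point. [folklore] -/
theorem ballFunction_chart_eventuallyEq {F : M → V} {A : Set M} (hA : IsOpen A) {f : M → ℝ}
    (hf : ∀ x ∈ A, f x = -(√(1 + ‖F x‖ ^ 2))⁻¹) {y : M} (hy : y ∈ A) :
    f ∘ (extChartAt (𝓡 m) y).symm =ᶠ[𝓝 (extChartAt (𝓡 m) y y)]
      fun w => -(√(1 + ‖(F ∘ (extChartAt (𝓡 m) y).symm) w‖ ^ 2))⁻¹ := by
  have hN : (extChartAt (𝓡 m) y).target ∩ (extChartAt (𝓡 m) y).symm ⁻¹' A ∈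
      𝓝 (extChartAt (𝓡 m) y y) :=
    ((continuousOn_extChartAt_symm y).isOpen_inter_preimage (isOpen_extChartAt_target y)
      hA).mem_nhds ⟨mem_extChartAt_target y, by rw [mem_preimage, extChartAt_to_inv]; exact hy⟩
  filter_upwards [hN] with w hw
  exact hf _ hw.2

/-- The ball function is smooth on `A`. [folklore] -/
theorem contMDiffOn_ballFunction {F : M → V} {A : Set M}
    (hF : ContMDiffOn (𝓡 m) 𝓘(ℝ, V) ∞ F A) {f : M → ℝ}
    (hf : ∀ x ∈ A, f x = -(√(1 + ‖F x‖ ^ 2))⁻¹) : ContMDiffOn (𝓡 m) 𝓘(ℝ, ℝ) ∞ f A :=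
  (contDiff_ballProfile.contMDiff.comp_contMDiffOn hF).congr hf

/-- **A critical point of the ball function is a zero of `F`** (where `dF` is onto): in the
chart, `D(-(√(1 + ‖Φ‖²))⁻¹) = c • ⟪Φ, DΦ ·⟫` with `c ≠ 0`. [folklore] -/
theorem apply_eq_zero_of_mfderiv_eq_zero [IsManifold (𝓡 m) ∞ M] {F : M → V} {A : Set M}
    (hA : IsOpen A)
    (hF : ContMDiffOn (𝓡 m) 𝓘(ℝ, V) ∞ F A) {f : M → ℝ}
    (hf : ∀ x ∈ A, f x = -(√(1 + ‖F x‖ ^ 2))⁻¹) {y : M} (hy : y ∈ A)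
    (hsurj : Function.Surjective (mfderiv (𝓡 m) 𝓘(ℝ, V) F y))
    (h0 : mfderiv (𝓡 m) 𝓘(ℝ, ℝ) f y = 0) : F y = 0 := by
  obtain ⟨hNo, hyN, hFc, hdF⟩ := chart_facts hA hF hy
  obtain ⟨-, -, -, hdf⟩ := chart_facts hA (contMDiffOn_ballFunction hF hf) hy
  have heq := ballFunction_chart_eventuallyEq (m := m) (F := F) hA hf hy
  have hΦ : HasFDerivAt (F ∘ (extChartAt (𝓡 m) y).symm)
      (fderiv ℝ (F ∘ (extChartAt (𝓡 m) y).symm) (extChartAt (𝓡 m) y y))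
      (extChartAt (𝓡 m) y y) :=
    ((hFc.contDiffAt (hNo.mem_nhds hyN)).differentiableAt (by simp)).hasFDerivAt
  rw [hdF] at hsurj
  have h0' : fderiv ℝ (fun w => -(√(1 + ‖(F ∘ (extChartAt (𝓡 m) y).symm) w‖ ^ 2))⁻¹)
      (extChartAt (𝓡 m) y y) = 0 := by
    rw [← heq.fderiv_eq]
    exact hdf.symm.trans h0
  have h := eq_zero_of_fderiv_ballProfile_comp_eq_zero hΦ hsurj h0'
  rwa [Function.comp_apply, extChartAt_to_inv] at h

/-- The Hessian of `f` at `y`, unfolded: the second derivative of `f` read in the extended chart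
at `y` (`Literature.Topology.FourManifolds.mhessian`, boundaryless model `𝓡 m`). [folklore] -/
theorem mhessian_apply_apply (f : M → ℝ) (y : M) (u v : EuclideanSpace ℝ (Fin m)) :
    Literature.Topology.FourManifolds.mhessian (𝓡 m) f y u v =
      fderiv ℝ (fderiv ℝ (f ∘ (extChartAt (𝓡 m) y).symm)) (extChartAt (𝓡 m) y y) u v := by
  have hw : writtenInExtChartAt (𝓡 m) 𝓘(ℝ, ℝ) y f = f ∘ (extChartAt (𝓡 m) y).symm := rfl
  simp only [Literature.Topology.FourManifolds.mhessian, hw, ModelWithCorners.range_eq_univ,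
    fderivWithin_univ]
  rfl

/-- **At a zero of `F` where `dF` is injective, the ball function is critical with
positive-definite Hessian**: in the chart the first derivative is `c • ⟪Φ, DΦ ·⟫ = 0` and the
second is `(u, v) ↦ ⟪DΦ u, DΦ v⟫` (`fderiv_fderiv_ballProfile_comp`). [folklore] -/
theorem mfderiv_eq_zero_and_posDef_mhessian [IsManifold (𝓡 m) ∞ M] {F : M → V} {A : Set M}
    (hA : IsOpen A)
    (hF : ContMDiffOn (𝓡 m) 𝓘(ℝ, V) ∞ F A) {f : M → ℝ}
    (hf : ∀ x ∈ A, f x = -(√(1 + ‖F x‖ ^ 2))⁻¹) {y : M} (hy : y ∈ A) (hFy : F y = 0)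
    (hinj : Function.Injective (mfderiv (𝓡 m) 𝓘(ℝ, V) F y)) :
    mfderiv (𝓡 m) 𝓘(ℝ, ℝ) f y = 0 ∧
      (Literature.Topology.FourManifolds.mhessian (𝓡 m) f y).toQuadraticMap.PosDef := by
  obtain ⟨hNo, hyN, hFc, hdF⟩ := chart_facts hA hF hy
  obtain ⟨-, -, -, hdf⟩ := chart_facts hA (contMDiffOn_ballFunction hF hf) hy
  have heq := ballFunction_chart_eventuallyEq (m := m) (F := F) hA hf hy
  set e := extChartAt (𝓡 m) y with he
  set Φ : (EuclideanSpace ℝ (Fin m)) → V := F ∘ e.symm with hΦ_def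
  have hΦev : ∀ᶠ w in 𝓝 (e y), HasFDerivAt Φ (fderiv ℝ Φ w) w := by
    filter_upwards [hNo.mem_nhds hyN] with w hw
    exact ((hFc.contDiffAt (hNo.mem_nhds hw)).differentiableAt (by simp)).hasFDerivAt
  have hΦ' : HasFDerivAt (fderiv ℝ Φ) (fderiv ℝ (fderiv ℝ Φ) (e y)) (e y) :=
    (((hFc.contDiffAt (hNo.mem_nhds hyN)).fderiv_right (m := 1)
      (WithTop.coe_le_coe.2 le_top)).differentiableAt one_ne_zero).hasFDerivAt
  have hΦ0 : Φ (e y) = 0 := by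
    rw [hΦ_def, Function.comp_apply, he, extChartAt_to_inv, hFy]
  rw [hdF] at hinj
  have hinj' : ∀ u, fderiv ℝ Φ (e y) u = 0 → u = 0 := fun u hu0 =>
    hinj (show fderiv ℝ Φ (e y) u = fderiv ℝ Φ (e y) 0 by rw [map_zero]; exact hu0)
  refine ⟨?_, fun u hu => ?_⟩
  · suffices h : (fderiv ℝ (f ∘ e.symm) (e y) : (EuclideanSpace ℝ (Fin m)) →L[ℝ] ℝ) = 0 by
      rw [hdf]; exact h
    rw [heq.fderiv_eq, (hasFDerivAt_ballProfile_comp hΦev.self_of_nhds).fderiv]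
    simp [hΦ0]
  · rw [LinearMap.BilinMap.toQuadraticMap_apply, mhessian_apply_apply, ← he,
      heq.fderiv.fderiv_eq, fderiv_fderiv_ballProfile_comp hΦev hΦ' hΦ0 u u]
    exact real_inner_self_pos.2 fun h => hu (hinj' u h)

/-- **Post-composition with a function of non-zero derivative keeps a point non-critical.**
[folklore] -/
theorem mfderiv_comp_ne_zero {ρ : ℝ → ℝ} {d : ℝ} {σ : M → ℝ} {y : M}
    (hσ : MDifferentiableAt (𝓡 m) 𝓘(ℝ, ℝ) σ y) (hρ : HasDerivAt ρ d (σ y)) (hd : d ≠ 0)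
    (hne : mfderiv (𝓡 m) 𝓘(ℝ, ℝ) σ y ≠ 0) : mfderiv (𝓡 m) 𝓘(ℝ, ℝ) (ρ ∘ σ) y ≠ 0 := by
  have hρm : HasMFDerivAt 𝓘(ℝ, ℝ) 𝓘(ℝ, ℝ) ρ (σ y)
      (ContinuousLinearMap.smulRight (1 : ℝ →L[ℝ] ℝ) d) := hρ.hasFDerivAt.hasMFDerivAt
  rw [mfderiv_comp y hρm.mdifferentiableAt hσ, hρm.mfderiv]
  intro h
  apply hne
  ext v
  have h1 : (ContinuousLinearMap.smulRight (1 : ℝ →L[ℝ] ℝ) d) (mfderiv (𝓡 m) 𝓘(ℝ, ℝ) σ y v) =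
      0 :=
    congrArg (fun L : TangentSpace (𝓡 m) y →L[ℝ] TangentSpace 𝓘(ℝ, ℝ) (ρ (σ y)) => L v) h
  rw [ContinuousLinearMap.smulRight_apply, one_apply_eq_self, smul_eq_mul,
    mul_eq_zero] at h1
  exact h1.resolve_right hd

end Chart

/-- **Registered sub-goal (explicit binders, universe `0`)**: at a zero of `F` where `dF` is
injective the ball function is critical with positive-definite Hessian,
`mfderiv_eq_zero_and_posDef_mhessian`. [folklore] -/
theorem stub_ballFunction_posDefHessian :
    ∀ (m : ℕ) (M : Type) [TopologicalSpace M] [ChartedSpace (EuclideanSpace ℝ (Fin m)) M]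
      [IsManifold (𝓡 m) ∞ M] (V : Type) [NormedAddCommGroup V] [InnerProductSpace ℝ V]
      (F : M → V) (A : Set M) (f : M → ℝ) (y : M), IsOpen A → ContMDiffOn (𝓡 m) 𝓘(ℝ, V) ∞ F A →
      (∀ x ∈ A, f x = -(√(1 + ‖F x‖ ^ 2))⁻¹) → y ∈ A → F y = 0 →
      Function.Injective (mfderiv (𝓡 m) 𝓘(ℝ, V) F y) →
      mfderiv (𝓡 m) 𝓘(ℝ, ℝ) f y = 0 ∧
        (Literature.Topology.FourManifolds.mhessian (𝓡 m) f y).toQuadraticMap.PosDef :=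
  fun _ _ _ _ _ _ _ _ _ _ _ _ hA hF hf hy hFy hinj =>
    mfderiv_eq_zero_and_posDef_mhessian hA hF hf hy hFy hinj

end Summit.SmoothPoincare4.SmoothPoincare4.Theorems.OrigamiRung.PairRigidityEndgame

end
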